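import Literature.NumberTheory.EllipticCurves.ComplexMultiplicationBurungaleFlachCorOneProofs
import Literature.NumberTheory.EllipticCurves.ShaTorsion
import Mathlib.RingTheory.DedekindDomain.AdicValuation
import Mathlib.RingTheory.DedekindDomain.Factorization
import Mathlib.RingTheory.Ideal.Norm.AbsNorm
import Mathlib.GroupTheory.PGroup
import Mathlib.GroupTheory.Perm.Cycle.Type
import Mathlib.GroupTheory.Torsion
import Mathlib.Data.Nat.Factorization.Induction
import HarnessLib

/-!
# bsd.S28 (Burungale–Flach): Theorem 1.1 over the CM field from its two printed halves, by the
printed proof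

Fourth proof file of `Literature.NumberTheory.EllipticCurves.ComplexMultiplication` for
**bsd.S28**; sibling of `ComplexMultiplicationBurungaleFlachCorOneProofs.lean`, whose level-3
leaf `Literature.NumberTheory.EllipticCurves.BurungaleFlach2024_main_cmField` is Burungale–Flach, Camb. J. Math. 12 (2024),
**Theorem 1.1 with Remark 1 at `F = K`** for the base change `E_K` of a CM curve `E/ℚ` (CM by
`𝓞_K`, `L(E/ℚ,1) ≠ 0`): `E(K)`, `Ш(E/K)` finite, `z := L(ψ̄,1)/Ω ∈ K^×` and
`z² · #E(K)² = u · #Ш(E/K) · ∏_v c_v` with `u ∈ 𝓞_K^×` (the printed identity of fractional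
`𝓞_K`-ideals `(L(ψ̄,1)/Ω) = |Ш(E/F)|_K/|E(F)| · ∏_v|Φ_v|_K · 𝔞(Ω)`, squared, with `𝔞(Ω) = (1)`).
The paper proves Theorem 1.1 (= "Theorem (main)") **one rational prime at a time**; the whole
proof is the paragraph on arXiv p. 22:

> *Proof (of Theorem (main)).* It suffices to produce an element `z` as in Prop. (keyelliptic)
> [= Prop. 2.3] for all prime numbers `p`. The content of Lemma (descent5) [= Lemma 13] is
> precisely that the element `z` satisfies the assumptions of Prop. (keyelliptic) for
> `S = {v ∣ p𝔣}`. Since it was shown in Prop. (descent) [= Prop. 4.1] that the `p`-primary part of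
> `Ш(E/F)` (and of `E(F)`) is finite for any prime `p`, the finiteness of `Ш(E/F)` follows from
> the global formula for its cardinality given by Prop. (keyelliptic). This concludes the proof
> of Theorem (main). □

where Proposition 2.3 (arXiv p. 12) reads: *"Let `E/F` be an elliptic curve with CM by `𝓞_K` and
associated Serre–Tate character `ψ`. Assume that `L(ψ̄,1) ≠ 0`. Let `p` be any prime number, …
Assume that `Ш(E/F)_{p^∞}` and `E(F)` are finite and … Assume there exists `z ∈ det_{K_p}
H¹(𝓞_{F,S}, V)` and a fractional `𝓞_K`-ideal `𝔞(z)` prime to `p` with the following properties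
a) b) c) [it is an `𝓞_{K_p}`-basis of `det⁻¹ RΓ(𝓞_{F,S},T)`, rational, and goes to
`L_S(ψ̄,1)·𝔞(z)·det(∏_v H¹(E(F_v),ℤ))` under the period isomorphism]. Then `L(ψ̄,1)/Ω ∈ K^×` and
`L(ψ̄,1)/Ω = |Ш(E/F)|_{K_p}/|E(F)| · ∏_v|Φ_v|_{K_p} · 𝔞(Ω)` in the group of fractional
`𝓞_K`-ideals supported in `{𝔭 ∣ p}`"* (`|M|_{K_p}` "the part of the order ideal of a finite
`𝓞_K`-module `M` supported in `{𝔭 ∣ p}`", p. 7, i.e. the order ideal of `M ⊗ ℤ_p = M[p^∞]`);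
Proposition 4.1 (p. 19, the descent, via Lemma 9, of the two-variable main conjecture
Theorem 4.1 of Johnson-Leung–Kings) ends with *"Moreover, the Selmer group
`Sel(K, T_{𝓞_{L_𝔓}}(φ)(1))` is finite"* (whence `E(F)` and `Ш(E/F)_{p^∞}` are finite, as used on
pp. 20 and 22; Remark 10: *"the finiteness of the Mordell–Weil group is due to Coates and Wiles,
Arthaud and Rubin. For `L = K` the finiteness of the Tate–Shafarevich group is due to Rubin
[rubin87]"*); and Lemma 13 (p. 22) produces, from Prop. 4.1 and Kato's explicit reciprocity law
(Prop. 3.1, Cor. 9), the element `z = z_{p^∞𝔣}(γ̃₁) ∧ ⋯ ∧ z_{p^∞𝔣}(γ̃_d)` with a), b), c).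

This file performs exactly this step, sorry-free, for the curves of the level-3 leaf. The two
printed inputs of the paragraph are vendored, in the transcription of level 3 (same data
`W, K, W'` and, for the formula, `σ, L, Ω`; same dictionary), as the named facts

* `BurungaleFlach2024_finite_primary_cmField` — Prop. 4.1 (with Remark 10): for every rational
  prime `p`, `E(K)` and `Ш(E/K)[p^∞]` are finite;
* `BurungaleFlach2024_main_cmField_pPart` — Prop. 2.3 with Lemma 13: for every rational prime
  `p`, *assuming* that finiteness (as Prop. 2.3 does), `L(ψ̄,1)/Ω ∈ K^×` and the identity of the
  `{𝔭 ∣ p}`-parts (squared by Remark 1: the equality of the `𝔭`-adic valuations, for all primes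
  `𝔭 ∋ p` of `𝓞_K`, of `z² · #E(K)²` and `#Ш(E/K)[p^∞] · ∏_v c_v`, Mathlib's
  `IsDedekindDomain.HeightOneSpectrum.valuation`) — the Iwasawa-theoretic heart of the paper;

and the last sentence of the printed proof, together with the tacit passage from "identity of
fractional ideals supported in `{𝔭 ∣ p}` for every `p`" to "identity of fractional ideals", is
**proved**, per curve and with the prime-by-prime data as an explicit hypothesis:

* `finite_shaFinite_exists_unit_of_primaryParts` : for a Weierstrass curve `W'` over a number
  field `K`, `σ : K →+* ℂ`, `Ω ≠ 0`, `ℓ ≠ 0`: if for every `p` the groups `W'(K)`, `Ш[p^∞]` are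
  finite and some `z` with `σ z · Ω = ℓ` satisfies the identity of `{𝔭 ∣ p}`-parts, then `Ш` is
  finite and `z² · #W'(K)² = u · #Ш · ∏_v c_v` with `u ∈ 𝓞_K^×`. Ingredients, all proved here or
  in the tree: `Ш` is a torsion group with finite primary parts almost all of which vanish, hence
  finite (`WeierstrassCurve.shaFinite_of_primary`, `ShaTorsion.lean` — the shape in which
  Rubin 1987 §10 concludes as well); the vanishing: for `𝔭 ∋ p` prime to `x·y·#W'(K)·∏_v c_v`
  (`z = x/y`), the identity forces `#Ш[p^∞] = p^k` (`Literature.NumberTheory.EllipticCurves.exists_natCard_primaryComponent_eq_pow`)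
  to be a `𝔭`-unit, so `k = 0`; then `v_𝔭(#Ш) = v_𝔭(#Ш[p^∞])` for `𝔭 ∋ p` (Lagrange and
  Cauchy: `#Ш = #Ш[p^∞] · m` with `p ∤ m`, `Literature.NumberTheory.EllipticCurves.exists_natCard_eq_card_primaryComponent_mul`),
  so the two sides of the global identity have the same valuation at every `𝔭`, and an element
  of `K^×` which is a unit at every `𝔭` is a unit of `𝓞_K` (`Literature.NumberTheory.EllipticCurves.exists_unit_eq_of_valuation_eq_one`,
  from Mathlib's `HeightOneSpectrum.mem_integers_of_valuation_le_one`);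
* `valuation_sq_mul_sq_eq_of_eq_unit_mul` : the converse per curve (the `{𝔭 ∣ p}`-parts read off
  from the identity of fractional ideals);
* `BurungaleFlach2024_main_cmField_of_halves` : the two halves ⇒ Theorem 1.1 at `F = K` (the
  level-3 leaf); `BurungaleFlach2024_main_cmField_pPart_of_main`,
  `BurungaleFlach2024_finite_primary_cmField_of_main` : the converses, so that
  `BurungaleFlach2024_main_cmField_iff_halves` records that the level-3 leaf is *equivalent* to
  the conjunction of its two printed halves (given the CM period lattice, to produce the period
  data the leaf quantifies over) — the prime-by-prime reading adds nothing to and loses nothing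
  of the transcribed Theorem 1.1 with Remark 1;
* `BurungaleFlach2024_bsd_cmField_of_halves` and
  `bsdTriple_of_j_mem_maximalCMJInvariants_of_L_one_ne_zero_of_halves` : Corollary 1 over `K`
  and bsd.S28 from the two halves and the standard facts of levels 1–3.

(An intermediate named fact `BurungaleFlach2024_main_cmField_primaryPart` — Theorem 1.1 at
`F = K` restated prime by prime, proved equivalent to the level-3 leaf — was merged back into
these theorems on review of the decomposition: its content is the hypothesis of
`finite_shaFinite_exists_unit_of_primaryParts`.)

After this file bsd.S28 rests, sorry-free, on: the finiteness of `E(K)` and of the `Ш(E/K)[p^∞]`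
(Prop. 4.1; by Remark 10 also Coates–Wiles 1977 and Rubin 1987, cf. the tree's
`Rubin1987_sha_primary_finite` for `W.baseChange K`), the `p`-part of the `K`-equivariant BSD
formula for every rational prime `p` (Prop. 2.3 with Lemma 13: the two-variable main conjecture
of Johnson-Leung–Kings, Thm. 4.1, its descent Prop. 4.1, and Kato's explicit reciprocity law
Prop. 3.1 — the Iwasawa-theoretic heart, which for `𝔭 ∤ #𝓞_K^×` is also Rubin's theorem
[rubin91] quoted on p. 3, and for `𝔭 ∣ #𝓞_K^×` is the contribution of the paper), the CM period
lattice, Deuring's theorem, modularity, and the descent inputs of level 3. The next level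
(Prop. 2.3 itself, or Prop. 4.1) needs determinants of perfect complexes of `p`-adic étale
cohomology, Iwasawa cohomology over `ℤ_p⟦Gal(K(p^∞𝔣)/K)⟧` and elliptic units, none of which is
in the tree or in Mathlib.

## Design and faithfulness notes

* `#Ш(E/K)[p^∞]` is `Nat.card {c : W'.sha | ∃ j, p ^ j • c = 0}`, the convention of
  `ShaTorsion.lean` and of `Rubin1987_sha_primary_finite`; it is the cardinality of Mathlib's
  `AddCommGroup.primaryComponent W'.sha p` (`Literature.NumberTheory.EllipticCurves.coe_primaryComponent`, `rfl`).
* The `{𝔭 ∣ p}`-part of the printed identity, squared as at level 3 by Remark 1 (`|Φ_v|_K² =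
  (c_v)`; `|Ш[p^∞]|_K = (n_p)` with `n_p ∈ ℤ` and `N_{K/ℚ}`: `n_p² = #Ш[p^∞]`), is
  `v_𝔭(z² #E(K)²) = v_𝔭(#Ш[p^∞] ∏_v c_v)` for all `𝔭 ∋ p`; conversely it gives back the printed
  `{𝔭 ∣ p}`-part by halving. That this transcription is right is *checked* by the proved
  equivalence with the level-3 leaf (`BurungaleFlach2024_main_cmField_iff_halves`).
* `z` is quantified inside `∀ p` (as Prop. 2.3 concludes `L(ψ̄,1)/Ω ∈ K^×` for each `p`); it is
  pinned down by `σ z · Ω = L(E/ℚ,1)` (`Ω ≠ 0`, `σ` injective), which the assembly uses.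
* No positivity fact for `∏_v c_v` is needed: the identity at a prime above `2` has non-zero
  left-hand side.
* Vacuity: as for the level-3 leaf (`27a1`, `32a2`, `49a1`; `Ω` from the singular moduli).

## References

* A. Burungale, M. Flach, *The conjecture of Birch and Swinnerton-Dyer for certain elliptic curves
  with complex multiplication*, Camb. J. Math. 12 (2024), no. 2 (arXiv:2206.09874): Thm. 1.1 and
  Remark 1 (p. 3), p. 7 (`|M|_{L_p}`), Prop. 2.3 (p. 12), Prop. 3.1 and Cor. 9 (pp. 13–16),
  Thm. 4.1, Lemma 9, Prop. 4.1 and Remark 10 (pp. 17–19), Lemma 13 and the proof of Thm. 1.1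
  (p. 22). [BurungaleFlach2024]
* K. Rubin, *Tate–Shafarevich groups and L-functions of elliptic curves with complex
  multiplication*, Invent. Math. 89 (1987), §10 (through `ShaTorsion.lean`). [Rubin1987Sha]
* B. H. Gross, Progr. Math. 26 (1982), Prop. 3.7 and 4.5 — cited through Remark 1 of
  [BurungaleFlach2024].
-/

noncomputable section

open scoped Classical

open NumberField IsDedekindDomain

namespace Literature.NumberTheory.EllipticCurves

/-! ### Finite abelian groups: the `p`-primary component -/

section Primary

variable {A : Type*} [AddCommGroup A] (p : ℕ)

/-- The `p`-primary component `A[p^∞]` of an abelian group (Mathlib's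
`AddCommGroup.primaryComponent`) is the set `{a | ∃ j, pʲ a = 0}` used in `ShaTorsion.lean` and in
`Rubin1987_sha_primary_finite`. [folklore] -/
theorem coe_primaryComponent :
    ((AddCommGroup.primaryComponent A p : AddSubgroup A) : Set A) =
      {a : A | ∃ j : ℕ, p ^ j • a = 0} :=
  rfl

/-- `#A[p^∞]` computed on the subgroup or on the set `{a | ∃ j, pʲ a = 0}` agree. [folklore] -/
theorem natCard_primaryComponent :
    Nat.card (AddCommGroup.primaryComponent A p) = Nat.card {a : A | ∃ j : ℕ, p ^ j • a = 0} :=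
  rfl

/-- `A[p^∞]` is finite if the set `{a | ∃ j, pʲ a = 0}` is. [folklore] -/
theorem finite_primaryComponent_of_finite (h : Set.Finite {a : A | ∃ j : ℕ, p ^ j • a = 0}) :
    Finite (AddCommGroup.primaryComponent A p) :=
  h.to_subtype

variable [hp : Fact p.Prime]

/-- A finite `p`-primary abelian group has order a power of `p` (it is a `p`-group; Mathlib
`IsPGroup.iff_card`). [folklore] -/
theorem exists_natCard_primaryComponent_eq_pow [Finite (AddCommGroup.primaryComponent A p)] :
    ∃ k : ℕ, Nat.card (AddCommGroup.primaryComponent A p) = p ^ k := by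
  have hP : IsPGroup p (Multiplicative (AddCommGroup.primaryComponent A p)) := by
    intro g
    obtain ⟨k, hk⟩ := (AddCommGroup.mem_primaryComponent).1 (Multiplicative.toAdd g).2
    refine ⟨k, Multiplicative.toAdd.injective ?_⟩
    rw [toAdd_pow, toAdd_one]
    exact Subtype.ext (by simpa using hk)
  obtain ⟨k, hk⟩ := IsPGroup.iff_card.1 hP
  exact ⟨k, hk⟩

/-- **The order of a finite abelian group is the order of its `p`-primary component times an
integer prime to `p`** (Lagrange and Cauchy: the quotient `A/A[p^∞]` has no element of order
`p`, for if `p·ā = 0` then `p a ∈ A[p^∞]`, so `a ∈ A[p^∞]` and `ā = 0`). [folklore] -/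
theorem exists_natCard_eq_card_primaryComponent_mul [Finite A] :
    ∃ m : ℕ, Nat.card A = Nat.card (AddCommGroup.primaryComponent A p) * m ∧ ¬p ∣ m := by
  set P := AddCommGroup.primaryComponent A p
  refine ⟨Nat.card (A ⧸ P), ?_, fun hdvd => ?_⟩
  · rw [mul_comm]; exact P.card_eq_card_quotient_mul_card_addSubgroup
  · obtain ⟨x, hx⟩ := exists_prime_addOrderOf_dvd_card' (G := A ⧸ P) p hdvd
    obtain ⟨a, rfl⟩ := QuotientAddGroup.mk_surjective x
    have hpa : p • a ∈ P := by
      rw [← QuotientAddGroup.eq_zero_iff, QuotientAddGroup.mk_nsmul, ← hx]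
      exact addOrderOf_nsmul_eq_zero _
    obtain ⟨k, hk⟩ := (AddCommGroup.mem_primaryComponent).1 hpa
    have ha : a ∈ P :=
      (AddCommGroup.mem_primaryComponent).2 ⟨k + 1, by rw [pow_succ, mul_smul, hk]⟩
    rw [(QuotientAddGroup.eq_zero_iff a).2 ha, addOrderOf_zero] at hx
    exact hp.out.one_lt.ne hx

end Primary

/-! ### Primes of `𝓞 K`, rational primes and `𝔭`-adic valuations of rational integers -/

section Dedekind

variable {K : Type*} [Field K] [NumberField K]

/-- A rational integer coprime to a rational prime `p ∈ 𝔭` is a `𝔭`-unit: `m ∉ 𝔭`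
(Bézout: `ap + bm = 1`). [folklore] -/
theorem natCast_notMem_of_coprime (v : HeightOneSpectrum (𝓞 K)) {p m : ℕ}
    (hpv : (p : 𝓞 K) ∈ v.asIdeal) (hm : Nat.Coprime p m) : (m : 𝓞 K) ∉ v.asIdeal := by
  intro hmv
  obtain ⟨a, b, hab⟩ := Nat.isCoprime_iff_coprime.2 hm
  have h1 : (1 : 𝓞 K) ∈ v.asIdeal := by
    have hab' : ((a : ℤ) : 𝓞 K) * (p : 𝓞 K) + ((b : ℤ) : 𝓞 K) * (m : 𝓞 K) = 1 := by
      exact_mod_cast congrArg (Int.cast : ℤ → 𝓞 K) hab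
    rw [← hab']
    exact v.asIdeal.add_mem (v.asIdeal.mul_mem_left _ hpv) (v.asIdeal.mul_mem_left _ hmv)
  exact v.isPrime.ne_top ((Ideal.eq_top_iff_one _).2 h1)

/-- A prime `𝔭` of `𝓞 K` lies above a single rational prime. [folklore] -/
theorem natPrime_mem_unique (v : HeightOneSpectrum (𝓞 K)) {p q : ℕ} (hp : p.Prime)
    (hq : q.Prime) (hpv : (p : 𝓞 K) ∈ v.asIdeal) (hqv : (q : 𝓞 K) ∈ v.asIdeal) : p = q := by
  by_contra hne
  exact natCast_notMem_of_coprime v hpv ((Nat.coprime_primes hp hq).2 hne) hqv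

/-- Every prime `𝔭` of `𝓞 K` lies above a rational prime: `p ∈ 𝔭` for some prime number `p`
(`𝔭 ∋ N𝔭 = ∏ pᵢ` and `𝔭` is prime). [folklore] -/
theorem exists_natPrime_mem (v : HeightOneSpectrum (𝓞 K)) :
    ∃ p : ℕ, p.Prime ∧ (p : 𝓞 K) ∈ v.asIdeal := by
  have hN : (Ideal.absNorm v.asIdeal : 𝓞 K) ∈ v.asIdeal := Ideal.absNorm_mem _
  have hN0 : Ideal.absNorm v.asIdeal ≠ 0 := fun h => v.ne_bot (Ideal.absNorm_eq_zero_iff.1 h)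
  have key : ∀ n : ℕ, (n : 𝓞 K) ∈ v.asIdeal → n ≠ 0 →
      ∃ p : ℕ, p.Prime ∧ (p : 𝓞 K) ∈ v.asIdeal := by
    intro n
    induction n using induction_on_primes with
    | zero => intro _ h; exact absurd rfl h
    | one =>
      intro h _
      exact absurd ((Ideal.eq_top_iff_one _).2 (by simpa using h)) v.isPrime.ne_top
    | prime_mul p a hp ih =>
      intro h hpa
      rw [Nat.cast_mul] at h
      rcases v.isPrime.mem_or_mem h with h | h
      · exact ⟨p, hp, h⟩
      · exact ih h fun ha => hpa (by simp [ha])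
  exact key _ hN hN0

/-- A rational prime `p` is not a unit of `𝓞 K` (its norm is `p^{[K:ℚ]} ≠ ±1`), hence lies in some
prime `𝔭` of `𝓞 K`. [folklore] -/
theorem exists_heightOneSpectrum_natCast_mem {p : ℕ} (hp : p.Prime) :
    ∃ v : HeightOneSpectrum (𝓞 K), (p : 𝓞 K) ∈ v.asIdeal := by
  have hnu : ¬IsUnit (p : 𝓞 K) := by
    intro hu
    have h := hu.map (Algebra.norm ℤ)
    rw [show (p : 𝓞 K) = algebraMap ℤ (𝓞 K) (p : ℤ) by simp, Algebra.norm_algebraMap,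
      isUnit_pow_iff, Int.isUnit_iff_natAbs_eq, Int.natAbs_natCast] at h
    · exact hp.one_lt.ne' h
    · rw [RingOfIntegers.rank]; exact Module.finrank_pos.ne'
  obtain ⟨M, hM, hpM⟩ := Ideal.exists_le_maximal (Ideal.span {(p : 𝓞 K)})
    (fun h => hnu (Ideal.span_singleton_eq_top.1 h))
  have hMbot : M ≠ ⊥ := by
    intro h
    rw [h, le_bot_iff, Ideal.span_singleton_eq_bot] at hpM
    exact hp.ne_zero (by exact_mod_cast hpM)
  exact ⟨⟨M, hM.isPrime, hMbot⟩, hpM (Ideal.mem_span_singleton_self _)⟩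

/-- A rational integer outside `𝔭` has `𝔭`-adic valuation `1`. [folklore] -/
theorem valuation_natCast_eq_one (v : HeightOneSpectrum (𝓞 K)) {m : ℕ}
    (hm : (m : 𝓞 K) ∉ v.asIdeal) : v.valuation K (m : K) = 1 := by
  rw [show (m : K) = algebraMap (𝓞 K) K (m : 𝓞 K) by simp]
  exact v.valuation_eq_one_iff_notMem.2 hm

/-- A rational integer in `𝔭` has `𝔭`-adic valuation `< 1`. [folklore] -/
theorem valuation_natCast_lt_one (v : HeightOneSpectrum (𝓞 K)) {m : ℕ}
    (hm : (m : 𝓞 K) ∈ v.asIdeal) : v.valuation K (m : K) < 1 := by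
  rw [show (m : K) = algebraMap (𝓞 K) K (m : 𝓞 K) by simp]
  exact (v.valuation_lt_one_iff_mem _).2 hm

/-- If `p ∈ 𝔭` and `pᵏ` is a `𝔭`-unit then `k = 0`. [folklore] -/
theorem eq_zero_of_valuation_natCast_pow_eq_one (v : HeightOneSpectrum (𝓞 K)) {p k : ℕ}
    (hpv : (p : 𝓞 K) ∈ v.asIdeal) (h : v.valuation K ((p ^ k : ℕ) : K) = 1) : k = 0 := by
  by_contra hk
  have hmem : ((p ^ k : ℕ) : 𝓞 K) ∈ v.asIdeal := by
    rw [Nat.cast_pow]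
    exact Ideal.pow_mem_of_mem v.asIdeal hpv k (Nat.pos_of_ne_zero hk)
  exact (valuation_natCast_lt_one v hmem).ne h

/-- A unit of `𝓞 K` has `𝔭`-adic valuation `1` at every prime. [folklore] -/
theorem valuation_coe_unit_eq_one (v : HeightOneSpectrum (𝓞 K)) (u : (𝓞 K)ˣ) :
    v.valuation K ((u : 𝓞 K) : K) = 1 := by
  rw [RingOfIntegers.coe_eq_algebraMap]
  exact v.valuation_eq_one_iff_notMem.2 fun h =>
    v.isPrime.ne_top (Ideal.eq_top_of_isUnit_mem _ h u.isUnit)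

/-- **Local–global principle for units** (`h_K` arbitrary): an element of `K` whose `𝔭`-adic
valuation is `1` at every prime `𝔭` of `𝓞 K` is a unit of `𝓞 K` (it and its inverse are
integral at every prime, Mathlib `HeightOneSpectrum.mem_integers_of_valuation_le_one`).
[folklore] -/
theorem exists_unit_eq_of_valuation_eq_one {r : K}
    (h : ∀ v : HeightOneSpectrum (𝓞 K), v.valuation K r = 1) :
    ∃ u : (𝓞 K)ˣ, ((u : 𝓞 K) : K) = r := by
  have hr0 : r ≠ 0 := by
    obtain ⟨v, -⟩ := exists_heightOneSpectrum_natCast_mem (K := K) Nat.prime_two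
    intro hr
    have h1 := h v
    rw [hr, map_zero] at h1
    exact zero_ne_one h1
  obtain ⟨a, ha⟩ :=
    HeightOneSpectrum.mem_integers_of_valuation_le_one K r fun v => (h v).le
  obtain ⟨b, hb⟩ :=
    HeightOneSpectrum.mem_integers_of_valuation_le_one K r⁻¹ fun v => by
      rw [map_inv₀, h v, inv_one]
  have hab : a * b = 1 := by
    apply IsFractionRing.injective (𝓞 K) K
    rw [map_mul, map_one, ha, hb, mul_inv_cancel₀ hr0]
  exact ⟨Units.mkOfMulEqOne a b hab, ha⟩

end Dedekind

end Literature.NumberTheory.EllipticCurves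

namespace Literature.NumberTheory.EllipticCurves

open WeierstrassCurve

/-! ### The two printed halves of the proof of Theorem 1.1: Prop. 4.1 and Prop. 2.3, named facts -/

/-- **Burungale–Flach 2024, Proposition 4.1 (the finiteness half), at `F = K`, for every rational
prime `p` — transcribed.** Printed (arXiv p. 19, Prop. 4.1, last assertion): *"Moreover, the
Selmer group `Sel(K, T_{𝓞_{L_𝔓}}(φ)(1))` is finite"*, used on p. 22 as *"it was shown in
Prop. (descent) that the `p`-primary part of `Ш(E/F)` (and of `E(F)`) is finite for any prime
`p`"* (and on p. 20: *"hence the finiteness of `Ш(A/K)_{p^∞}` and of `A(K)` follow from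
Prop. (descent)"*); Remark 10 (p. 19): *"In the situation of Prop. (descent) the finiteness of
the Mordell–Weil group is due to Coates and Wiles [coates77], Arthaud [arthuad78] and Rubin
[rubin81]. For `L = K` the finiteness of the Tate–Shafarevich group is due to Rubin [rubin87]"*
(cf. the tree's `Rubin1987_sha_primary_finite`, the same assertion for `W.baseChange K`). Here,
for the curves and in the dictionary of the level-3 leaf `BurungaleFlach2024_main_cmField`
(`F = K`, `E = E_K` the base change of `E/ℚ` with `j(E) ∈ maximalCMJInvariants` and
`L(E/ℚ,1) ≠ 0`, which satisfies the hypotheses by p. 4, `K` with `IsCMFieldOfJ K j(E)`, `W'` a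
globally minimal model of `E_K` over `K`), and for the rational prime `p`:
`Ш(E/K)[p^∞] = {c ∈ W'.sha | ∃ j, p^j c = 0}` (as in `ShaTorsion.lean` and
`Rubin1987_sha_primary_finite`), "`Ш(E/F)_{p^∞}` finite" = `Set.Finite` of it: for every
rational prime `p`, `E(K) = W'(K)` is finite and `Ш(E/K)[p^∞]` is finite.
[cite: BurungaleFlach2024, Prop. 4.1 (arXiv p. 19) with Remark 10 and proof of Thm. 1.1 (p. 22)] -/
def BurungaleFlach2024_finite_primary_cmField : Prop :=
  ∀ (W : WeierstrassCurve ℚ) [W.IsElliptic], W.j ∈ maximalCMJInvariants →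
    W.entireLFunction 1 ≠ 0 →
    ∀ (K : Type) [Field K] [NumberField K], IsCMFieldOfJ K W.j →
      ∀ (W' : WeierstrassCurve K) [W'.IsElliptic] [W'.IsGloballyMinimal],
        (∃ C : VariableChange K, C • W.baseChange K = W') →
          ∀ p : ℕ, p.Prime →
            Finite W'.toAffine.Point ∧ Set.Finite {c : W'.sha | ∃ j : ℕ, p ^ j • c = 0}

/-- **Burungale–Flach 2024, Proposition 2.3 with Lemma 13 (the `p`-part of the `K`-equivariant
BSD formula, assuming the finiteness), at `F = K`, for every rational prime `p` — transcribed.**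
Printed (Prop. 2.3, arXiv p. 12): *"Let `E/F` be an elliptic curve with CM by `𝓞_K` and
associated Serre–Tate character `ψ`. Assume that `L(ψ̄,1) ≠ 0`. Let `p` be any prime number,
`T = T_p(ᵗE)`, `V = T ⊗ ℚ_p` and `S` a finite set of places of `F` containing `{v ∣ p∞}` and all
places of bad reduction. Assume that `Ш(E/F)_{p^∞}` and `E(F)` are finite and let `ι` be the
isomorphism of Prop. (key). Assume there exists `z ∈ det_{K_p} H¹(𝓞_{F,S},V)` and a fractional
`𝓞_K`-ideal `𝔞(z)` prime to `p` with the following properties a) `𝓞_{K_p}·z =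
det⁻¹_{𝓞_{K_p}} RΓ(𝓞_{F,S},T)` b) `ι(z) ∈ det_K H⁰(E,Ω_{E/F})` c) `𝓞_K·det_{K_ℝ}(per_E)(ι(z))
= L_S(ψ̄,1)·𝔞(z)·det_{𝓞_K}(∏_{v∣∞} H¹(E(F_v),ℤ))`. Then `L(ψ̄,1)/Ω ∈ K^×` and
`L(ψ̄,1)/Ω = |Ш(E/F)|_{K_p}/|E(F)| · ∏_v|Φ_v|_{K_p} · 𝔞(Ω)` in the group of fractional
`𝓞_K`-ideals supported in `{𝔭 ∣ p}`"*; the existence of such a `z` for every `p` is Lemma 13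
(p. 22: `z = z_{p^∞𝔣}(γ̃₁) ∧ ⋯ ∧ z_{p^∞𝔣}(γ̃_d)`, from the main conjecture Thm. 4.1 through
Prop. 4.1, and Kato's reciprocity law Prop. 3.1 / Cor. 9), *"The content of Lemma (descent5) is
precisely that the element `z` satisfies the assumptions of Prop. (keyelliptic)"*, and Remark 1
(p. 3): *"the ideal `|Ш(E/F)|_K` is generated by a rational integer [Gross, Prop. 3.7]. The ideals
`|Φ_v|_K` are equal to either `(1)`, `(2)` or `𝔭` with `𝔭² = (2)` or `𝔭² = (3)` [Gross,
Prop. 4.5]."* Here, for the curves, data and dictionary of the level-3 leaf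
`BurungaleFlach2024_main_cmField` (see there and the module docstring of
`ComplexMultiplicationBurungaleFlachCorOneProofs.lean`: `σ : K →+* ℂ`, `L` the period lattice
of `W'` along `σ`, `Ω` an `𝓞_K`-generator of it (`𝔞(Ω) = (1)`), `L(ψ̄,1) = L(E/ℚ,1) =
W.entireLFunction 1`, "`L(ψ̄,1)/Ω ∈ K^×`" = `∃ z : K, σ z · Ω = L(E/ℚ,1)`, `|E(K)| = Nat.card
W'(K)`, `|Φ_v| = c_v`, `∏_v c_v = W'.tamagawaProduct`) and, for the rational prime `p`,
`Ш(E/K)[p^∞] = {c ∈ W'.sha | ∃ j, p^j c = 0}`, `#Ш(E/K)[p^∞] = Nat.card` of it: the identity of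
`{𝔭 ∣ p}`-parts, squared by Remark 1 and `N_{K/ℚ}|A|_K = |A|` as at level 3
(`|Ш[p^∞]|_K² = (#Ш[p^∞])`, `|Φ_v|_K² = (c_v)`), says that the principal fractional ideals
`(z² · #E(K)²)` and `(#Ш(E/K)[p^∞] · ∏_v c_v)` have the same `{𝔭 ∣ p}`-part, i.e. the same
`𝔭`-adic valuation (Mathlib's `HeightOneSpectrum.valuation K`, values in `ℤₘ₀`) at every prime
`𝔭` of `𝓞_K` with `p ∈ 𝔭`. So: for every rational prime `p`, *if* `E(K)` and `Ш(E/K)[p^∞]` are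
finite *then* `∃ z : K, σ z · Ω = L(E/ℚ,1)` and `v_𝔭(z² · #E(K)²) = v_𝔭(#Ш(E/K)[p^∞] · ∏_v c_v)`
for every prime `𝔭 ∋ p` of `𝓞_K`.
[cite: BurungaleFlach2024, Prop. 2.3 (arXiv p. 12) with Lemma 13 (p. 22) and Remark 1 (p. 3)] -/
def BurungaleFlach2024_main_cmField_pPart : Prop :=
  ∀ (W : WeierstrassCurve ℚ) [W.IsElliptic], W.j ∈ maximalCMJInvariants →
    W.entireLFunction 1 ≠ 0 →
    ∀ (K : Type) [Field K] [NumberField K], IsCMFieldOfJ K W.j →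
      ∀ (W' : WeierstrassCurve K) [W'.IsElliptic] [W'.IsGloballyMinimal],
        (∃ C : VariableChange K, C • W.baseChange K = W') →
        ∀ (σ : K →+* ℂ) (L : PeriodPair) (Ω : ℂ),
          L.g₂ = (W'.map σ).c₄ / 12 → L.g₃ = (W'.map σ).c₆ / 216 →
          (L.lattice : Set ℂ) = (fun α : ℂ => Ω * α) '' (cmRing (cmDiscr W.j) : Set ℂ) →
          ∀ p : ℕ, p.Prime →
            Finite W'.toAffine.Point → Set.Finite {c : W'.sha | ∃ j : ℕ, p ^ j • c = 0} →
              ∃ z : K, σ z * Ω = W.entireLFunction 1 ∧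
                ∀ v : HeightOneSpectrum (𝓞 K), (p : 𝓞 K) ∈ v.asIdeal →
                  v.valuation K (z ^ 2 * (Nat.card W'.toAffine.Point : K) ^ 2) =
                    v.valuation K
                      ((Nat.card {c : W'.sha | ∃ j : ℕ, p ^ j • c = 0} : K) *
                        (W'.tamagawaProduct : K))

/-- The period data of the leaves exist (bookkeeping, as in the proof of
`BurungaleFlach2024_bsd_cmField_of_main`): given the CM period lattice `Λ_E = Ω · 𝓞_K` of `E/ℚ`
(`hΛ`, Coates–Wiles 1977 §1 / the singular moduli), for `W' = C • E_K` and any `σ : K →+* ℂ` the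
pair `σ(u)⁻¹ L` (`ω_{C•W} = u ω_W`) is a period pair of `W'.map σ` with lattice
`(σ(u) Ω) · 𝓞_K`.
[cite: BurungaleFlach2024, §1 (arXiv p. 3: `H_1(E(F_v),ℤ)` is an invertible `𝓞_K`-module)] -/
theorem exists_periodPair_of_smul_baseChange
    (hΛ : exists_isCMPeriod_of_j_mem_maximalCMJInvariants) (W : WeierstrassCurve ℚ)
    [W.IsElliptic] (hj : W.j ∈ maximalCMJInvariants) {K : Type*} [Field K] [NumberField K]
    (W' : WeierstrassCurve K) (hW' : ∃ C : VariableChange K, C • W.baseChange K = W')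
    (σ : K →+* ℂ) :
    ∃ (L : PeriodPair) (Ω : ℂ), L.g₂ = (W'.map σ).c₄ / 12 ∧ L.g₃ = (W'.map σ).c₆ / 216 ∧
      (L.lattice : Set ℂ) = (fun α : ℂ => Ω * α) '' (cmRing (cmDiscr W.j) : Set ℂ) := by
  obtain ⟨C, rfl⟩ := hW'
  obtain ⟨Ω, L, ⟨h₂, h₃⟩, hLΩ⟩ := hΛ W hj
  have hu : σ (C.u : K) ≠ 0 := (map_ne_zero σ).mpr C.u.ne_zero
  have hmap : (C • W.baseChange K).map σ = (C.map σ) • W.baseChange ℂ :=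
    map_smul_baseChange_eq W C σ
  have hCu : (((C.map σ).u : ℂˣ) : ℂ) = σ (C.u : K) := by
    rw [VariableChange.map_u, Units.coe_map, MonoidHom.coe_coe]
  have hinv : (((C.map σ).u⁻¹ : ℂˣ) : ℂ) = (σ (C.u : K))⁻¹ := by
    rw [Units.val_inv_eq_inv_val, hCu]
  refine ⟨L.mulLeft _ hu, σ (C.u : K) * Ω, ?_, ?_, coe_mulLeft_lattice_of_eq_image L hu hLΩ⟩
  · rw [hmap, PeriodPair.g₂_mulLeft, variableChange_c₄, h₂, hinv, inv_pow]
    ring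
  · rw [hmap, PeriodPair.g₃_mulLeft, variableChange_c₆, h₃, hinv, inv_pow]
    ring

/-! ### The last sentence of the printed proof, per curve, and the glue of the two halves -/

section PerCurve

variable {K : Type*} [Field K] [NumberField K]

/-- **The last sentence of the printed proof of Theorem 1.1, per curve, with the tacit
local–global passage** (Burungale–Flach 2024, proof of Thm. (main), arXiv p. 22: *"Since it was
shown in Prop. (descent) that the `p`-primary part of `Ш(E/F)` (and of `E(F)`) is finite for any
prime `p`, the finiteness of `Ш(E/F)` follows from the global formula for its cardinality given by
Prop. (keyelliptic)"*). For a Weierstrass curve `W'` over a number field `K`, `σ : K →+* ℂ`,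
`Ω ≠ 0` and a value `ℓ ≠ 0` (in the application `ℓ = L(ψ̄,1)`): if for every rational prime `p`
the group `W'(K)` and the `p`-primary part `Ш[p^∞]` are finite and there is `z ∈ K` with
`σ z · Ω = ℓ` and `v_𝔭(z² · #W'(K)²) = v_𝔭(#Ш[p^∞] · ∏_v c_v)` for all primes `𝔭 ∋ p` of `𝓞_K`,
then `Ш` is finite and `z² · #W'(K)² = u · #Ш · ∏_v c_v` for a unit `u ∈ 𝓞_K^×`. Proof: `z`
is pinned down by `σ z · Ω = ℓ` (take the one at `p = 2`); writing `z = x/y` (`x, y ∈ 𝓞_K`), for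
every prime `𝔭 ∤ x·y·#W'(K)·∏_v c_v` and the rational prime `p ∈ 𝔭` the identity at `𝔭` makes
`#Ш[p^∞] = p^k` a `𝔭`-unit, so `Ш[p^∞] = 0` for all `p` outside a finite set; `Ш` being torsion
with finite primary parts, it is finite (`WeierstrassCurve.shaFinite_of_primary`); then for every
`𝔭`, with `p ∈ 𝔭`, `v_𝔭(#Ш) = v_𝔭(#Ш[p^∞])` (`#Ш = #Ш[p^∞]·m`, `p ∤ m`), so both sides of the
global identity have the same valuation everywhere and their quotient is a unit of `𝓞_K`
(`exists_unit_eq_of_valuation_eq_one`).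
[cite: BurungaleFlach2024, proof of Thm. 1.1 (arXiv p. 22)] -/
theorem finite_shaFinite_exists_unit_of_primaryParts (W' : WeierstrassCurve K) (σ : K →+* ℂ)
    {Ω ℓ : ℂ} (hΩ : Ω ≠ 0) (hℓ : ℓ ≠ 0)
    (hT' : ∀ p : ℕ, p.Prime →
      Finite W'.toAffine.Point ∧ Set.Finite {c : W'.sha | ∃ j : ℕ, p ^ j • c = 0} ∧
        ∃ z : K, σ z * Ω = ℓ ∧
          ∀ v : HeightOneSpectrum (𝓞 K), (p : 𝓞 K) ∈ v.asIdeal →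
            v.valuation K (z ^ 2 * (Nat.card W'.toAffine.Point : K) ^ 2) =
              v.valuation K
                ((Nat.card {c : W'.sha | ∃ j : ℕ, p ^ j • c = 0} : K) *
                  (W'.tamagawaProduct : K))) :
    Finite W'.toAffine.Point ∧ W'.ShaFinite ∧
      ∃ (z : K) (u : (𝓞 K)ˣ), σ z * Ω = ℓ ∧
        z ^ 2 * (Nat.card W'.toAffine.Point : K) ^ 2 =
          ((u : 𝓞 K) : K) * (W'.shaOrder : K) * (W'.tamagawaProduct : K) := by
  -- `p = 2`: finiteness of `W'(K)` and the element `z ∈ K`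
  obtain ⟨hfin, -, z, hz, -⟩ := hT' 2 Nat.prime_two
  haveI := hfin
  -- `z` is determined by `σ z · Ω = ℓ`
  have hzuniq : ∀ z' : K, σ z' * Ω = ℓ → z' = z := fun z' hz' =>
    σ.injective (mul_right_cancel₀ hΩ (hz'.trans hz.symm))
  -- the prime-by-prime data, with the fixed `z`
  have hP : ∀ p : ℕ, p.Prime →
      Set.Finite {c : W'.sha | ∃ j : ℕ, p ^ j • c = 0} ∧
        ∀ v : HeightOneSpectrum (𝓞 K), (p : 𝓞 K) ∈ v.asIdeal →
          v.valuation K (z ^ 2 * (Nat.card W'.toAffine.Point : K) ^ 2) =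
            v.valuation K
              ((Nat.card {c : W'.sha | ∃ j : ℕ, p ^ j • c = 0} : K) *
                (W'.tamagawaProduct : K)) := by
    intro p hp
    obtain ⟨-, hprim, z', hz', hv⟩ := hT' p hp
    obtain rfl := hzuniq z' hz'
    exact ⟨hprim, hv⟩
  -- notation and non-vanishing
  set n : ℕ := Nat.card W'.toAffine.Point with hn_def
  set t : ℕ := W'.tamagawaProduct with ht_def
  have hn0 : n ≠ 0 := Nat.card_pos.ne'
  have hz0 : z ≠ 0 := by
    rintro rfl
    rw [map_zero, zero_mul] at hz
    exact hℓ hz.symm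
  have hzn0 : z ^ 2 * (n : K) ^ 2 ≠ 0 :=
    mul_ne_zero (pow_ne_zero _ hz0) (pow_ne_zero _ (Nat.cast_ne_zero.2 hn0))
  -- `z = x / y` with `x, y ∈ 𝓞 K`
  obtain ⟨x, y, hy, hxy⟩ := IsFractionRing.div_surjective (A := 𝓞 K) z
  have hy0 : y ≠ 0 := nonZeroDivisors.ne_zero hy
  have hx0 : x ≠ 0 := by
    rintro rfl
    rw [map_zero, zero_div] at hxy
    exact hz0 hxy.symm
  -- `∏_v c_v ≠ 0` (the identity at a prime above `2` has non-zero left hand side)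
  have ht0 : t ≠ 0 := by
    obtain ⟨v, hv2⟩ := exists_heightOneSpectrum_natCast_mem (K := K) Nat.prime_two
    have h := (hP 2 Nat.prime_two).2 v hv2
    intro ht
    rw [ht, Nat.cast_zero, mul_zero, map_zero, Valuation.zero_iff] at h
    exact hzn0 h
  -- the finitely many primes of `𝓞 K` dividing `x · y · #W'(K) · ∏_v c_v`
  set D : 𝓞 K := x * y * (n : 𝓞 K) * (t : 𝓞 K) with hD_def
  have hD0 : D ≠ 0 :=
    mul_ne_zero (mul_ne_zero (mul_ne_zero hx0 hy0) (Nat.cast_ne_zero.2 hn0))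
      (Nat.cast_ne_zero.2 ht0)
  have hfac : {v : HeightOneSpectrum (𝓞 K) | v.asIdeal ∣ Ideal.span {D}}.Finite :=
    Ideal.finite_factors (by rwa [Ne, Ideal.zero_eq_bot, Ideal.span_singleton_eq_bot])
  -- away from them, `Ш[p^∞] = 0` for the rational prime `p` below: its order `p^k` is a `𝔭`-unit
  have hgood : ∀ p : ℕ, p.Prime → ∀ v : HeightOneSpectrum (𝓞 K), (p : 𝓞 K) ∈ v.asIdeal →
      ¬v.asIdeal ∣ Ideal.span {D} → Nat.card {c : W'.sha | ∃ j : ℕ, p ^ j • c = 0} = 1 := by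
    intro p hp v hpv hvD
    rw [Ideal.dvd_span_singleton] at hvD
    have hxv : x ∉ v.asIdeal := fun h =>
      hvD (Ideal.mul_mem_right _ _ (Ideal.mul_mem_right _ _ (Ideal.mul_mem_right _ _ h)))
    have hyv : y ∉ v.asIdeal := fun h =>
      hvD (Ideal.mul_mem_right _ _ (Ideal.mul_mem_right _ _ (Ideal.mul_mem_left _ _ h)))
    have hnv : (n : 𝓞 K) ∉ v.asIdeal := fun h =>
      hvD (Ideal.mul_mem_right _ _ (Ideal.mul_mem_left _ _ h))
    have htv : (t : 𝓞 K) ∉ v.asIdeal := fun h => hvD (Ideal.mul_mem_left _ _ h)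
    haveI : Fact p.Prime := ⟨hp⟩
    haveI : Finite (AddCommGroup.primaryComponent W'.sha p) :=
      finite_primaryComponent_of_finite p (hP p hp).1
    obtain ⟨k, hk⟩ := exists_natCard_primaryComponent_eq_pow (A := W'.sha) p
    rw [natCard_primaryComponent] at hk
    have hval := (hP p hp).2 v hpv
    have hvz : v.valuation K z = 1 := by
      rw [← hxy, map_div₀, v.valuation_eq_one_iff_notMem.2 hxv,
        v.valuation_eq_one_iff_notMem.2 hyv, div_one]
    rw [map_mul, map_mul, map_pow, map_pow, hvz, valuation_natCast_eq_one v hnv,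
      valuation_natCast_eq_one v htv, one_pow, one_mul, mul_one, hk, eq_comm] at hval
    rw [hk, eq_zero_of_valuation_natCast_pow_eq_one v hpv hval, pow_zero]
  -- hence `Ш` is finite (it is torsion with finite primary parts, almost all zero)
  have hsha : W'.ShaFinite := by
    refine W'.shaFinite_of_primary (fun p hp => (hP p hp).1) ?_
    -- the exceptional rational primes: those below the prime factors of `D`
    let pv : HeightOneSpectrum (𝓞 K) → ℕ := fun v => Classical.choose (exists_natPrime_mem v)
    have hpv : ∀ v, (pv v).Prime ∧ ((pv v : ℕ) : 𝓞 K) ∈ v.asIdeal := fun v =>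
      Classical.choose_spec (exists_natPrime_mem v)
    refine ⟨hfac.toFinset.image pv, fun p hp hpS c hc => ?_⟩
    obtain ⟨v, hpv'⟩ := exists_heightOneSpectrum_natCast_mem (K := K) hp
    have hvD : ¬v.asIdeal ∣ Ideal.span {D} := fun h =>
      hpS (Finset.mem_image.2
        ⟨v, hfac.mem_toFinset.2 h, natPrime_mem_unique v (hpv v).1 hp (hpv v).2 hpv'⟩)
    have h1 := hgood p hp v hpv' hvD
    have hc' : c ∈ {c : W'.sha | ∃ j : ℕ, p ^ j • c = 0} := ⟨1, by rwa [pow_one]⟩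
    have h0 : (0 : W'.sha) ∈ {c : W'.sha | ∃ j : ℕ, p ^ j • c = 0} := ⟨0, smul_zero _⟩
    have hsub := (Nat.card_eq_one_iff_unique.1 h1).1
    exact congrArg Subtype.val (hsub.elim ⟨c, hc'⟩ ⟨0, h0⟩)
  haveI : Finite W'.sha := hsha
  have hs0 : W'.shaOrder ≠ 0 := (W'.shaOrder_pos hsha).ne'
  -- the identity of valuations at every prime, with `#Ш` in place of `#Ш[p^∞]`
  have hall : ∀ v : HeightOneSpectrum (𝓞 K),
      v.valuation K (z ^ 2 * (n : K) ^ 2) = v.valuation K ((W'.shaOrder : K) * (t : K)) := by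
    intro v
    obtain ⟨p, hp, hpv⟩ := exists_natPrime_mem v
    haveI : Fact p.Prime := ⟨hp⟩
    obtain ⟨m, hm, hpm⟩ := exists_natCard_eq_card_primaryComponent_mul (A := W'.sha) p
    have hsha' : (W'.shaOrder : K) =
        (Nat.card {c : W'.sha | ∃ j : ℕ, p ^ j • c = 0} : K) * (m : K) := by
      rw [WeierstrassCurve.shaOrder, hm, natCard_primaryComponent, Nat.cast_mul]
    rw [(hP p hp).2 v hpv, hsha']
    simp only [map_mul,
      valuation_natCast_eq_one v (natCast_notMem_of_coprime v hpv (hp.coprime_iff_not_dvd.2 hpm)),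
      mul_one]
  -- so the quotient is a unit of `𝓞 K`
  have hst0 : (W'.shaOrder : K) * (t : K) ≠ 0 :=
    mul_ne_zero (Nat.cast_ne_zero.2 hs0) (Nat.cast_ne_zero.2 ht0)
  obtain ⟨u, hu⟩ := exists_unit_eq_of_valuation_eq_one (K := K)
    (r := z ^ 2 * (n : K) ^ 2 / ((W'.shaOrder : K) * (t : K))) fun v => by
      rw [map_div₀, hall v, div_self ((Valuation.ne_zero_iff _).2 hst0)]
  refine ⟨hfin, hsha, z, u, hz, ?_⟩
  rw [mul_assoc, hu, div_mul_cancel₀ _ hst0]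

/-- **The `{𝔭 ∣ p}`-parts from the global identity, per curve** (the converse bookkeeping, as
in the printed statement of Prop. 2.3 read off from Thm. 1.1): if `Ш` is finite and
`z² · #W'(K)² = u · #Ш · ∏_v c_v` with `u ∈ 𝓞_K^×`, then for every rational prime `p` and every
prime `𝔭 ∋ p` of `𝓞_K`, `v_𝔭(z² · #W'(K)²) = v_𝔭(#Ш[p^∞] · ∏_v c_v)` (`v_𝔭(u) = 0`, and
`#Ш = #Ш[p^∞]·m` with `p ∤ m`, `m` a `𝔭`-unit).
[cite: BurungaleFlach2024, Thm. 1.1 and Remark 1 (arXiv p. 3), Prop. 2.3 (p. 12)] -/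
theorem valuation_sq_mul_sq_eq_of_eq_unit_mul (W' : WeierstrassCurve K) [Finite W'.sha] {z : K}
    (u : (𝓞 K)ˣ)
    (hzu : z ^ 2 * (Nat.card W'.toAffine.Point : K) ^ 2 =
      ((u : 𝓞 K) : K) * (W'.shaOrder : K) * (W'.tamagawaProduct : K))
    {p : ℕ} (hp : p.Prime) (v : HeightOneSpectrum (𝓞 K)) (hpv : (p : 𝓞 K) ∈ v.asIdeal) :
    v.valuation K (z ^ 2 * (Nat.card W'.toAffine.Point : K) ^ 2) =
      v.valuation K
        ((Nat.card {c : W'.sha | ∃ j : ℕ, p ^ j • c = 0} : K) * (W'.tamagawaProduct : K)) := by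
  haveI : Fact p.Prime := ⟨hp⟩
  obtain ⟨m, hm, hpm⟩ := exists_natCard_eq_card_primaryComponent_mul (A := W'.sha) p
  have hsha' : (W'.shaOrder : K) =
      (Nat.card {c : W'.sha | ∃ j : ℕ, p ^ j • c = 0} : K) * (m : K) := by
    rw [WeierstrassCurve.shaOrder, hm, natCard_primaryComponent, Nat.cast_mul]
  rw [hzu, hsha']
  simp only [map_mul, valuation_coe_unit_eq_one v u, one_mul,
    valuation_natCast_eq_one v (natCast_notMem_of_coprime v hpv (hp.coprime_iff_not_dvd.2 hpm)),
    mul_one]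

end PerCurve

/-- **Theorem 1.1 with Remark 1 at `F = K` (the level-3 leaf) from its two printed halves,
directly**: Prop. 4.1 (`hA`: `E(K)` and `Ш(E/K)[p^∞]` finite for every `p`) and Prop. 2.3 with
Lemma 13 (`hB`: the `{𝔭 ∣ p}`-part of the formula for every `p`, given the finiteness), by the
last sentence of the printed proof (`finite_shaFinite_exists_unit_of_primaryParts`).
[cite: BurungaleFlach2024, proof of Thm. 1.1 (arXiv p. 22) with Prop. 2.3, Prop. 4.1, Lemma 13] -/
theorem BurungaleFlach2024_main_cmField_of_halves
    (hA : BurungaleFlach2024_finite_primary_cmField)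
    (hB : BurungaleFlach2024_main_cmField_pPart) : BurungaleFlach2024_main_cmField := by
  intro W _ hj hL K _ _ hK W' _ _ hW' σ L Ω h₂ h₃ hLΩ
  exact finite_shaFinite_exists_unit_of_primaryParts W' σ
    (ne_zero_of_coe_lattice_eq_image L hLΩ) hL fun p hp =>
      have hfp := hA W hj hL K hK W' hW' p hp
      ⟨hfp.1, hfp.2, hB W hj hL K hK W' hW' σ L Ω h₂ h₃ hLΩ p hp hfp.1 hfp.2⟩

/-- **Theorem 1.1 at `F = K` ⇒ its Prop. 2.3 half** (a faithfulness check: the `{𝔭 ∣ p}`-parts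
of the printed identity are read off from the identity of fractional ideals,
`valuation_sq_mul_sq_eq_of_eq_unit_mul`).
[cite: BurungaleFlach2024, Thm. 1.1 and Remark 1 (arXiv p. 3), Prop. 2.3 (p. 12)] -/
theorem BurungaleFlach2024_main_cmField_pPart_of_main (hT : BurungaleFlach2024_main_cmField) :
    BurungaleFlach2024_main_cmField_pPart := by
  intro W _ hj hL K _ _ hK W' _ _ hW' σ L Ω h₂ h₃ hLΩ p hp _ _
  obtain ⟨-, hsha, z, u, hz, hzu⟩ := hT W hj hL K hK W' hW' σ L Ω h₂ h₃ hLΩ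
  haveI : Finite W'.sha := hsha
  exact ⟨z, hz, fun v hpv => valuation_sq_mul_sq_eq_of_eq_unit_mul W' u hzu hp v hpv⟩

/-- **Theorem 1.1 at `F = K` ⇒ its Prop. 4.1 half**, given the CM period lattice (`hΛ`, to
produce the period data the leaf quantifies over, `exists_periodPair_of_smul_baseChange`):
`Ш(E/K)` finite ⇒ every `Ш(E/K)[p^∞]` finite.
[cite: BurungaleFlach2024, Thm. 1.1 (arXiv p. 3), Prop. 4.1 (p. 19)] -/
theorem BurungaleFlach2024_finite_primary_cmField_of_main (hT : BurungaleFlach2024_main_cmField)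
    (hΛ : exists_isCMPeriod_of_j_mem_maximalCMJInvariants) :
    BurungaleFlach2024_finite_primary_cmField := by
  intro W _ hj hL K _ _ hK W' _ _ hW' p _
  obtain ⟨w⟩ : Nonempty (InfinitePlace K) := inferInstance
  obtain ⟨L, Ω, h₂, h₃, hLΩ⟩ := exists_periodPair_of_smul_baseChange hΛ W hj W' hW' w.embedding
  obtain ⟨hfin, hsha, -⟩ := hT W hj hL K hK W' hW' w.embedding L Ω h₂ h₃ hLΩ
  haveI : Finite W'.sha := hsha
  exact ⟨hfin, Set.toFinite _⟩

/-- **Level 3 ⇔ its two printed halves** (given the CM period lattice `hΛ`, already a leaf of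
the level-3 assembly): Theorem 1.1 with Remark 1 at `F = K` ⇔ (Prop. 4.1: finiteness of `E(K)`
and `Ш(E/K)[p^∞]` for all `p`) ∧ (Prop. 2.3 with Lemma 13: the `p`-part of the formula for all
`p`, given the finiteness). The printed proof (arXiv p. 22) goes from right to left.
[cite: BurungaleFlach2024, proof of Thm. 1.1 (arXiv p. 22)] -/
theorem BurungaleFlach2024_main_cmField_iff_halves
    (hΛ : exists_isCMPeriod_of_j_mem_maximalCMJInvariants) :
    BurungaleFlach2024_main_cmField ↔
      BurungaleFlach2024_finite_primary_cmField ∧ BurungaleFlach2024_main_cmField_pPart :=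
  ⟨fun h => ⟨BurungaleFlach2024_finite_primary_cmField_of_main h hΛ,
    BurungaleFlach2024_main_cmField_pPart_of_main h⟩,
    fun h => BurungaleFlach2024_main_cmField_of_halves h.1 h.2⟩

/-! ### Assembly down to Corollary 1 over `K` and bsd.S28 -/

/-- **Corollary 1 at `F = K` (the level-2 leaf) from the two level-4 halves** and the inputs of
the level-3 assembly (CM period lattice `hΛ`, Deuring `hD`, modularity `hmod`), through
Theorem 1.1 at `F = K` (`BurungaleFlach2024_main_cmField_of_halves`) and
`BurungaleFlach2024_bsd_cmField_of_main`.
[cite: BurungaleFlach2024, Thm. 1.1 and its proof, Cor. 1 and its proof (arXiv pp. 3, 22)] -/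
theorem BurungaleFlach2024_bsd_cmField_of_halves
    (hA : BurungaleFlach2024_finite_primary_cmField)
    (hB : BurungaleFlach2024_main_cmField_pPart)
    (hΛ : exists_isCMPeriod_of_j_mem_maximalCMJInvariants)
    (hD : Deuring_LFunction_baseChange_cmField) (hmod : hasEntireLFunction_rat) :
    BurungaleFlach2024_bsd_cmField :=
  BurungaleFlach2024_bsd_cmField_of_main (BurungaleFlach2024_main_cmField_of_halves hA hB) hΛ hD
    hmod

/-- **bsd.S28 from the two level-4 halves of Burungale–Flach's Theorem 1.1 and the standard facts
of levels 1–3** (as in `bsdTriple_of_j_mem_maximalCMJInvariants_of_L_one_ne_zero_of_main`).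
[cite: BurungaleFlach2024, Thm. 1.1, Cor. 1, Cor. 2 (arXiv pp. 3–4, 22)] -/
theorem bsdTriple_of_j_mem_maximalCMJInvariants_of_L_one_ne_zero_of_halves
    (hA : BurungaleFlach2024_finite_primary_cmField)
    (hB : BurungaleFlach2024_main_cmField_pPart)
    (hΛ : exists_isCMPeriod_of_j_mem_maximalCMJInvariants)
    (hD : Deuring_LFunction_baseChange_cmField) (hmod : hasEntireLFunction_rat)
    (hBCL : LSeries_baseChange_quadratic) (hBC : bsdRHS_baseChange_quadratic)
    (hISO : bsdRHS_eq_of_isIsogenous) (hKn : LFunction_eq_of_isIsogenous)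
    (hPOS : re_entireLFunction_one_nonneg) (hTW : isIsogenous_quadraticTwist_cmFieldDiscr) :
    bsdTriple_of_j_mem_maximalCMJInvariants_of_L_one_ne_zero :=
  bsdTriple_of_j_mem_maximalCMJInvariants_of_L_one_ne_zero_of_main
    (BurungaleFlach2024_main_cmField_of_halves hA hB) hΛ hD hmod hBCL hBC hISO hKn hPOS hTW

end Literature.NumberTheory.EllipticCurves

end
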